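import Summits.QuantumFields.YangMills.Theorems.BalabanUVNodesN15KingModelBoxCosineBasis
import Summits.QuantumFields.YangMills.Theorems.BalabanUVNodesN15KingModelBoxFolding
import Summits.QuantumFields.YangMills.Theorems.BalabanUVNodesN15KingModelBlockFieldDeterminant
import HarnessLib

/-!
# BalabanUVNodes ∕ N15 — THE KING-MODEL RUNG (PART Ϟ-b): THE SPECTRUM OF A FOLDED REFLECTION-SYMMETRIC TORUS OPERATOR —
# `fold(A)·w_k = σ(k̂)·w_k` for EVERY reflection-symmetric `A` on the doubled torus `Π_μℤ∕2n_μ` with the plane-wave eigen-equation `Σ_y A(x,y)e^{ik̂·y} = σ(k̂)e^{ik̂·x}` at the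
# half-grid momentum `k̂ = dblBox k`; hence `det fold(A) = Π_{k∈Ω} σ(k̂)` and `tr fold(A) = Σ_{k∈Ω} σ(k̂)` — THE NEUMANN-BOX SPECTRUM IS THE DOUBLED-TORUS SYMBOL ON THE HALF GRID
# (Track A, DAG node N15 = NE2; FAN-OUT v1.1 §N15 s3 «KING-MODEL RUNG»; the free-boundary operators of King p.670 diagonalised; count-neutral)

HONEST FRAMING.  Count-neutral (cell `pub-ymgap`, seat `pub-ymgap-dag-n15-e` g41; `--supports stmt-QuantumFields-27366 --as helper` = K3⁸).
TEMPLATE LITERATURE: C. King, Commun. Math. Phys. **102** (1986) 649–677 [King1986], §4 p.670 l.8–13 («… the propagators `G^η_k` and `G^η_k(Ω)` can be written in terms of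
the operator defined by (2.13) with free boundary conditions … Such representations are given explicitly in [Ba 4], so it is sufficient to prove Propositions 3.8 and 3.9 for
the operator with free boundary conditions»), (4.4)–(4.5) p.670 and (4.35) p.674 (plane-wave symbols on the torus); [Balaban1983RegularityDecay] (2.42) p.584 (the multiple
reflections).  Part Ν-f (g39) typed the FOLDING `fold(A)(s,t) = Σ_S A(dblBox s, σ_S dblBox t)` of a reflection-symmetric operator of the doubled torus `Π_μℤ∕2n_μ` onto King's
region `Ω = Π_μ{0,…,n_μ−1}` (`foldOp`, `IsReflSymm`, `foldOp_mulVec`, the homomorphism `fold(AB) = fold(A)fold(B)`), part Ϟ-a the cosine (DCT-II) basis `w_k` of `Ω`.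
THIS FILE diagonalises EVERY such folded operator in that basis, by ONE device: the REFLECTION-AVERAGED PLANE WAVE `E_p(y) := Σ_{S⊆{0..d}} e^{ip·σ_S y}` of the doubled torus.
§1 def **`evenWaveC n p`**; ★★ **`sum_mul_evenWaveC_of_eigen`**: if `A` is reflection symmetric and `Σ_y A(x,y)e^{ip·y} = σe^{ip·x}` then `Σ_y A(x,y)E_p(y) = σE_p(x)`
(reindex `y ↦ σ_S y` in each summand and use `A(x, σ_S y) = A(σ_S x, y)`).  §2 at a HALF-GRID momentum `p = k̂ := dblBox k` (`k ∈ Ω`, reduced momentum `πk_μ∕n_μ`):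
`stdAddChar_natCast_mul_of_rep`, `chi_dblBox_torReflS` (the character at `σ_S y` through the integer representatives `−1−v_μ` ∕ `v_μ`), `prod_ite_mem_eq`,
`evenWaveC_dblBox_eq_prod` (`E_{k̂}(y) = Π_μ(e^{iθ_μv_μ} + e^{−iθ_μ(1+v_μ)})`, `θ_μ = πk_μ∕n_μ` — `Fintype.prod_add`), `exp_add_exp_eq_two_cos`, def **`waveConst n k = Π_μ 2e^{−iθ_μ∕2}`**
(`≠ 0`), `cos_foldZ`, `cos_foldBox`,
★★ **`evenWaveC_dblBox_eq`**: `E_{k̂}(y) = waveConst k · w_k(foldBox y)` — the reflection average of the plane wave IS the even extension of the cosine wave.  §3 ★★★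
**`foldOp_mulVec_boxWave`**: `IsReflSymm A` + the eigen-equation at `k̂` with real eigenvalue `σ` ⇒ `fold(A)·w_k = σ·w_k`; ★★★ **`det_foldOp_eq_prod`** (`det fold(A) =
Π_{k∈Ω} σ(k)` when the eigen-equation holds at every `k̂`), ★★ **`trace_foldOp_eq_sum`**, `foldOp_inv_mulVec_boxWave`.  §4 ★★ **`eigen_chi_of_fourierForm`**: an operator given in
King's plane-wave form `A(b,b′) = |Ω|⁻¹Σ_q τ(q)·Re e^{iq·(b′−b)}` with an even symbol `τ` (the shape of `effLaplacian_apply_eq_fourier`, Ε-n's `det_eq_prod_of_evenSymbol`) satisfies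
the eigen-equation `Σ_y A(x,y)e^{iq·y} = τ(q)e^{iq·x}` at EVERY momentum; ★★ **`det_foldOp_eq_prod_of_fourierForm`**, **`foldOp_mulVec_boxWave_of_fourierForm`**.

PRIOR TREE ART (named, USED not restated): Ν-a∕Ν-b∕Ν-d∕Ν-f `…BoxOperator`∕`…BoxTimeSlices`∕`…BoxForm`∕`…BoxFolding` (`KingBox`, `dblBox`, `torReflS`, `torReflS_torReflS`,
`foldZ`, `foldBox`, `foldBox_dblBox`, `foldOp`, `IsReflSymm`, `foldOp_mulVec`, `foldOp_inv`, `isUnit_foldOp`), Ϟ-a `…BoxCosineBasis` (`boxWave`, `det_eq_prod_of_boxWave_eigen`,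
`trace_eq_sum_of_boxWave_eigen`, `inv_mulVec_boxWave_of_eigen`), Ε-n `…BlockFieldDeterminant` (`sum_evenSymbol_chi_eq_re`), `B5Prop11Plancherel` (`chi`, `sum_chi`,
`chi_add_left∕right`, `chi_neg_neg`), Mathlib (`ZMod.stdAddChar_coe`, `Fintype.prod_add`, `Finset.prod_piecewise`, `Complex.two_cos`).  The INSTANCES (King's `c(−Δ)+m²` with
free boundary conditions = `boxOp`, the folded RG block-field operator `fold(Δ^{(K)})`, King's (3.89)∕(3.93) on Ω) are part Ϟ-c.  NOT Bałaban's covariant objects; NOT a node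
discharge (N15 is booked through n15-a's knit, untouched); nothing continuum-YM ∕ `ℝ⁴` ∕ OS ∕ Clay.  0 `sorry`; 2 `def`s (`evenWaveC`, `waveConst`).

HONEST SCOPE.  Finite-dimensional linear algebra on the doubled torus `Π_μℤ∕2n_μ` and on `Ω = Π_μ Fin n_μ` (every `d`, all `n_μ ≥ 1`), for ANY real matrix `A` that is
reflection symmetric with a plane-wave eigen-equation (no positivity, no nearest-neighbour structure); the eigenvalue of `fold(A)` at `w_k` is the torus eigenvalue at the
half-grid momentum `k̂ = ((k_μ : ℤ∕2n_μ))_μ`, reduced momentum `πk_μ∕n_μ ∈ [0, π)`.  Locators: [King1986] §4 p.670 l.8–13, (2.13) p.653, (4.4)–(4.5) p.670, (4.35) p.674;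
[Balaban1983RegularityDecay] (2.42) p.584.
-/

noncomputable section

open scoped BigOperators symmDiff
open Finset Matrix

namespace Summit.QuantumFields.YangMills.BalabanUVNodes.N15KingModelRung.TorusSpectral

open Literature.MathematicalPhysics.QuantumFieldTheory.Balaban1983to89.B5Prop11Plancherel (Tor chi sum_chi chi_add_left chi_add_right chi_neg_neg chi_zero_left)
open Literature.MathematicalPhysics.QuantumFieldTheory.King1986.Torus

variable {d : ℕ}

/-! ## §1 The reflection-averaged plane wave and its eigen-equation -/

section EvenWave

variable (n : Fin (d + 1) → ℕ) [hn : ∀ μ, NeZero (n μ)]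

/-- THE REFLECTION-AVERAGED PLANE WAVE of the doubled torus `Π_μℤ∕2n_μ` with momentum `p`: `E_p(y) := Σ_{S⊆{0,…,d}} e^{ip·σ_S y}` (sum over the `2^{d+1}` multi-reflections
`σ_S` of part Ν-a). [cite: King1986, §4 p.670, (4.35) p.674; Balaban1983RegularityDecay, (2.42) p.584] -/
def evenWaveC (p : Tor (dblPer n)) : Tor (dblPer n) → ℂ := fun y => ∑ S : Finset (Fin (d + 1)), chi (dblPer n) p (torReflS (dblPer n) S y)

/-- `E_p` is invariant under every multi-reflection: `E_p(σ_T y) = E_p(y)` (`σ_Sσ_T = σ_{S△T}` permutes the summands). [folklore] -/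
theorem evenWaveC_torReflS (p : Tor (dblPer n)) (T : Finset (Fin (d + 1))) (y : Tor (dblPer n)) :
    evenWaveC n p (torReflS (dblPer n) T y) = evenWaveC n p y := by
  unfold evenWaveC
  simp_rw [torReflS_torReflS_eq_symmDiff]
  exact Fintype.sum_equiv (Equiv.mk (fun S => S ∆ T) (fun S => S ∆ T) (fun S => by simp) (fun S => by simp)) _ _ (fun S => rfl)

/-- ★★ **THE EIGEN-EQUATION PASSES TO THE REFLECTION AVERAGE**: if `A` is reflection symmetric and `Σ_y A(x,y)e^{ip·y} = σ·e^{ip·x}` for all `x`, then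
`Σ_y A(x,y)E_p(y) = σ·E_p(x)` for all `x` (reindex `y ↦ σ_S y`, `A(x, σ_S y) = A(σ_S x, y)`). [cite: King1986, §4 p.670, (4.35) p.674] -/
theorem sum_mul_evenWaveC_of_eigen {A : Matrix (Tor (dblPer n)) (Tor (dblPer n)) ℝ} (hA : IsReflSymm n A) {p : Tor (dblPer n)} {σ : ℂ}
    (hq : ∀ x, ∑ y, (A x y : ℂ) * chi (dblPer n) p y = σ * chi (dblPer n) p x) (x : Tor (dblPer n)) :
    ∑ y, (A x y : ℂ) * evenWaveC n p y = σ * evenWaveC n p x := by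
  simp only [evenWaveC, Finset.mul_sum]
  rw [Finset.sum_comm]
  refine Finset.sum_congr rfl fun S _ => ?_
  rw [← Equiv.sum_comp (Function.Involutive.toPerm (torReflS (dblPer n) S) (torReflS_torReflS (dblPer n) S))]
  simp only [Function.Involutive.coe_toPerm]
  have e : ∀ y, (A x (torReflS (dblPer n) S y) : ℂ) * chi (dblPer n) p (torReflS (dblPer n) S (torReflS (dblPer n) S y))
      = (A (torReflS (dblPer n) S x) y : ℂ) * chi (dblPer n) p y := by
    intro y
    rw [torReflS_torReflS]
    congr 2
    have h := hA S (torReflS (dblPer n) S x) y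
    rw [torReflS_torReflS] at h
    exact h
  simp_rw [e]
  exact hq (torReflS (dblPer n) S x)

end EvenWave

/-! ## §2 At a half-grid momentum `k̂ = dblBox k`: `E_{k̂} = waveConst k · (w_k ∘ foldBox)` -/

section HalfGrid

variable (n : Fin (d + 1) → ℕ) [hn : ∀ μ, NeZero (n μ)]

/-- one character factor through an integer representative: `ψ_{2m}(k·x) = e^{iπkr∕m}` when `r ≡ x (mod 2m)`. [folklore] -/
theorem stdAddChar_natCast_mul_of_rep {m : ℕ} [NeZero m] (k : ℕ) (x : ZMod (2 * m)) (r : ℤ) (hr : ((r : ℤ) : ZMod (2 * m)) = x) :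
    (ZMod.stdAddChar (N := 2 * m) ((k : ZMod (2 * m)) * x) : ℂ) = Complex.exp (Complex.I * ((Real.pi * k * r / m : ℝ) : ℂ)) := by
  haveI : NeZero (2 * m) := ⟨by have := NeZero.ne m; omega⟩
  have h1 : (k : ZMod (2 * m)) * x = (((k * r : ℤ)) : ZMod (2 * m)) := by push_cast; rw [hr]
  rw [h1, ZMod.stdAddChar_coe]
  congr 1
  push_cast
  ring

/-- the character of the half-grid momentum `k̂` at a reflected point, factor by factor, through the representatives `v_μ := val y_μ` and `−1 − v_μ`:
`e^{ik̂·σ_S y} = Π_{μ∈S} e^{iθ_μ(−1−v_μ)} · Π_{μ∉S} e^{iθ_μ v_μ}`, `θ_μ = πk_μ∕n_μ`. [cite: King1986, (4.1) p.670, (4.35) p.674] -/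
theorem chi_dblBox_torReflS (k : KingBox n) (S : Finset (Fin (d + 1))) (y : Tor (dblPer n)) :
    chi (dblPer n) (dblBox n k) (torReflS (dblPer n) S y)
      = ∏ μ, (if μ ∈ S then Complex.exp (Complex.I * ((Real.pi * (k μ).val * ((-1 - ((y μ).val : ℤ) : ℤ) : ℝ) / n μ : ℝ) : ℂ))
          else Complex.exp (Complex.I * ((Real.pi * (k μ).val * (((y μ).val : ℤ) : ℝ) / n μ : ℝ) : ℂ))) := by
  unfold chi
  refine Finset.prod_congr rfl fun μ _ => ?_
  haveI : NeZero (n μ) := hn μ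
  have hdb : dblBox n k μ = ((k μ).val : ZMod (2 * n μ)) := rfl
  by_cases hμ : μ ∈ S
  · rw [if_pos hμ]
    have hrefl : torReflS (dblPer n) S y μ = -1 - y μ := by simp [torReflS, hμ]
    rw [hrefl, hdb, stdAddChar_natCast_mul_of_rep (k μ).val (-1 - y μ) (-1 - ((y μ).val : ℤ)) (by push_cast; rw [ZMod.natCast_zmod_val])]
  · rw [if_neg hμ]
    have hrefl : torReflS (dblPer n) S y μ = y μ := by simp [torReflS, hμ]
    rw [hrefl, hdb, stdAddChar_natCast_mul_of_rep (k μ).val (y μ) ((y μ).val : ℤ) (by push_cast; rw [ZMod.natCast_zmod_val])]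

/-- a product of a two-case function over all directions splits along `S`: `Π_μ (F_μ if μ ∈ S, G_μ else) = Π_{μ∈S}F_μ·Π_{μ∉S}G_μ`. [folklore] -/
theorem prod_ite_mem_eq {α : Type*} [CommMonoid α] (S : Finset (Fin (d + 1))) (F G : Fin (d + 1) → α) :
    ∏ μ, (if μ ∈ S then F μ else G μ) = (∏ μ ∈ S, F μ) * ∏ μ ∈ Sᶜ, G μ := by
  rw [← Finset.prod_mul_prod_compl S (fun μ => if μ ∈ S then F μ else G μ)]
  congr 1
  · exact Finset.prod_congr rfl fun μ hμ => if_pos hμ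
  · exact Finset.prod_congr rfl fun μ hμ => if_neg (Finset.mem_compl.mp hμ)

/-- `E_{k̂}(y) = Π_μ (e^{iθ_μ(−1−v_μ)} + e^{iθ_μ v_μ})` (`Σ_S Π_{μ∈S}f_μΠ_{μ∉S}g_μ = Π_μ(f_μ + g_μ)`). [folklore] -/
theorem evenWaveC_dblBox_eq_prod (k : KingBox n) (y : Tor (dblPer n)) :
    evenWaveC n (dblBox n k) y
      = ∏ μ, (Complex.exp (Complex.I * ((Real.pi * (k μ).val * ((-1 - ((y μ).val : ℤ) : ℤ) : ℝ) / n μ : ℝ) : ℂ))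
          + Complex.exp (Complex.I * ((Real.pi * (k μ).val * (((y μ).val : ℤ) : ℝ) / n μ : ℝ) : ℂ))) := by
  unfold evenWaveC
  simp_rw [chi_dblBox_torReflS]
  rw [Fintype.prod_add]
  exact Finset.sum_congr rfl fun S _ => prod_ite_mem_eq S _ _

/-- `e^{iθ(−1−v)} + e^{iθv} = 2e^{−iθ∕2}·cos(θ(v+½))`. [folklore] -/
theorem exp_add_exp_eq_two_cos (θ v : ℝ) :
    Complex.exp (Complex.I * ((θ * (-1 - v) : ℝ) : ℂ)) + Complex.exp (Complex.I * ((θ * v : ℝ) : ℂ))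
      = 2 * Complex.exp (-(Complex.I * ((θ / 2 : ℝ) : ℂ))) * ((Real.cos (θ * (v + 1 / 2)) : ℝ) : ℂ) := by
  rw [Complex.ofReal_cos, show ∀ c x : ℂ, 2 * c * Complex.cos x = c * (2 * Complex.cos x) from fun c x => by ring, Complex.two_cos, mul_add,
    ← Complex.exp_add, ← Complex.exp_add, add_comm]
  congr 1 <;> (congr 1; push_cast; ring)

/-- THE NORMALISING CONSTANT `waveConst k = Π_μ 2e^{−iπk_μ∕2n_μ}` relating the reflection average `E_{k̂}` to the cosine wave `w_k`. [folklore] -/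
def waveConst (k : KingBox n) : ℂ := ∏ μ, 2 * Complex.exp (-(Complex.I * ((Real.pi * (k μ).val / n μ / 2 : ℝ) : ℂ)))

omit hn in
/-- `waveConst k ≠ 0`. [folklore] -/
theorem waveConst_ne_zero (k : KingBox n) : waveConst n k ≠ 0 := by
  unfold waveConst
  exact Finset.prod_ne_zero_iff.mpr fun μ _ => mul_ne_zero two_ne_zero (Complex.exp_ne_zero _)

/-- the folding of one doubled coordinate does not change the cosine: `cos(πk((foldZ z).val+½)∕m) = cos(πk(val z+½)∕m)` (the mirror point `2m−1−v` gives `cos(2πk − ·)`).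
[folklore] -/
theorem cos_foldZ (m : ℕ) [NeZero m] (k : ℕ) (z : ZMod (2 * m)) :
    Real.cos (Real.pi * k * (((foldZ m z).val : ℕ) + 1 / 2) / m) = Real.cos (Real.pi * k * ((z.val : ℕ) + 1 / 2) / m) := by
  unfold foldZ
  split_ifs with h
  · rfl
  · haveI : NeZero (2 * m) := ⟨by have := NeZero.ne m; omega⟩
    have hz : z.val < 2 * m := ZMod.val_lt z
    have hmr : (m : ℝ) ≠ 0 := by exact_mod_cast NeZero.ne m
    have hle : m ≤ z.val := Nat.le_of_not_lt h
    have hcast : (((2 * m - 1 - z.val : ℕ) : ℕ) : ℝ) = 2 * m - 1 - z.val := by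
      rw [Nat.cast_sub (by omega), Nat.cast_sub (by omega)]; push_cast; ring
    dsimp only
    rw [hcast, show Real.pi * k * ((2 * (m : ℝ) - 1 - z.val) + 1 / 2) / m = (k : ℕ) * (2 * Real.pi) - Real.pi * k * ((z.val : ℝ) + 1 / 2) / m by field_simp; ring,
      Real.cos_nat_mul_two_pi_sub]

/-- the folded coordinate does not change the cosine factor of `w_k`. [folklore] -/
theorem cos_foldBox (k : KingBox n) (y : Tor (dblPer n)) (μ : Fin (d + 1)) :
    Real.cos (Real.pi * (k μ).val * (((foldBox n y μ).val : ℝ) + 1 / 2) / n μ) = Real.cos (Real.pi * (k μ).val * (((y μ).val : ℝ) + 1 / 2) / n μ) := by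
  haveI : NeZero (n μ) := hn μ
  exact cos_foldZ (n μ) (k μ).val (y μ)

/-- ★★ **THE REFLECTION AVERAGE OF THE PLANE WAVE IS THE EVEN EXTENSION OF THE COSINE WAVE**: `E_{k̂}(y) = waveConst k · w_k(foldBox y)` for every `k ∈ Ω` and every point
`y` of the doubled torus. [cite: King1986, §4 p.670, (4.35) p.674; Balaban1983RegularityDecay, (2.42) p.584] -/
theorem evenWaveC_dblBox_eq (k : KingBox n) (y : Tor (dblPer n)) :
    evenWaveC n (dblBox n k) y = waveConst n k * ((boxWave n k (foldBox n y) : ℝ) : ℂ) := by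
  rw [evenWaveC_dblBox_eq_prod, boxWave_apply, Complex.ofReal_prod, waveConst, ← Finset.prod_mul_distrib]
  refine Finset.prod_congr rfl fun μ _ => ?_
  haveI : NeZero (n μ) := hn μ
  have h := exp_add_exp_eq_two_cos (Real.pi * (k μ).val / n μ) ((y μ).val : ℝ)
  have e1 : ((Real.pi * (k μ).val * ((-1 - ((y μ).val : ℤ) : ℤ) : ℝ) / n μ : ℝ) : ℂ) = ((Real.pi * (k μ).val / n μ * (-1 - ((y μ).val : ℝ)) : ℝ) : ℂ) := by
    push_cast; ring
  have e2 : ((Real.pi * (k μ).val * (((y μ).val : ℤ) : ℝ) / n μ : ℝ) : ℂ) = ((Real.pi * (k μ).val / n μ * ((y μ).val : ℝ) : ℝ) : ℂ) := by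
    push_cast; ring
  have hb : Real.pi * (k μ).val / n μ * (((y μ).val : ℝ) + 1 / 2) = Real.pi * (k μ).val * (((y μ).val : ℝ) + 1 / 2) / n μ := by ring
  rw [hb] at h
  rw [e1, e2, h, cos_foldBox]

end HalfGrid

/-! ## §3 The folded operator is diagonal in the cosine basis -/

section Folded

variable (n : Fin (d + 1) → ℕ) [hn : ∀ μ, NeZero (n μ)]

/-- ★★★ **`fold(A)·w_k = σ·w_k`**: for every reflection-symmetric `A` on the doubled torus satisfying the plane-wave eigen-equation `Σ_y A(x,y)e^{ik̂·y} = σe^{ik̂·x}` at the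
half-grid momentum `k̂ = dblBox k` with a REAL eigenvalue `σ`, the cosine wave `w_k` is an eigenvector of the folded operator `fold(A)` on `Ω` with the SAME eigenvalue.
[cite: King1986, §4 p.670 l.8–13, (4.35) p.674; Balaban1983RegularityDecay, (2.42) p.584] -/
theorem foldOp_mulVec_boxWave {A : Matrix (Tor (dblPer n)) (Tor (dblPer n)) ℝ} (hA : IsReflSymm n A) (k : KingBox n) {σ : ℝ}
    (hq : ∀ x, ∑ y, (A x y : ℂ) * chi (dblPer n) (dblBox n k) y = (σ : ℂ) * chi (dblPer n) (dblBox n k) x) :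
    foldOp n A *ᵥ boxWave n k = σ • boxWave n k := by
  funext s
  rw [foldOp_mulVec, Pi.smul_apply, smul_eq_mul]
  simp only [Matrix.mulVec, dotProduct]
  have h := sum_mul_evenWaveC_of_eigen n hA hq (dblBox n s)
  simp_rw [evenWaveC_dblBox_eq] at h
  rw [foldBox_dblBox] at h
  have h2 : waveConst n k * (∑ y : Tor (dblPer n), (A (dblBox n s) y : ℂ) * ((boxWave n k (foldBox n y) : ℝ) : ℂ))
      = waveConst n k * ((σ : ℂ) * ((boxWave n k s : ℝ) : ℂ)) := by
    calc waveConst n k * (∑ y : Tor (dblPer n), (A (dblBox n s) y : ℂ) * ((boxWave n k (foldBox n y) : ℝ) : ℂ))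
        = ∑ y : Tor (dblPer n), (A (dblBox n s) y : ℂ) * (waveConst n k * ((boxWave n k (foldBox n y) : ℝ) : ℂ)) := by
          rw [Finset.mul_sum]; exact Finset.sum_congr rfl fun y _ => by ring
      _ = (σ : ℂ) * (waveConst n k * ((boxWave n k s : ℝ) : ℂ)) := h
      _ = waveConst n k * ((σ : ℂ) * ((boxWave n k s : ℝ) : ℂ)) := by ring
  have h3 := mul_left_cancel₀ (waveConst_ne_zero n k) h2
  apply Complex.ofReal_injective
  push_cast
  exact h3

/-- ★★★ **`det fold(A) = Π_{k∈Ω} σ(k)`** when the eigen-equation holds at every half-grid momentum `k̂` (eigenvalue `σ(k)`): THE NEUMANN-BOX DETERMINANT IS THE PRODUCT OF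
THE DOUBLED-TORUS SYMBOL OVER THE HALF GRID. [cite: King1986, §4 p.670 l.8–13, (3.89) p.668, (4.35) p.674] -/
theorem det_foldOp_eq_prod {A : Matrix (Tor (dblPer n)) (Tor (dblPer n)) ℝ} (hA : IsReflSymm n A) (σ : KingBox n → ℝ)
    (hq : ∀ (k : KingBox n) (x : Tor (dblPer n)), ∑ y, (A x y : ℂ) * chi (dblPer n) (dblBox n k) y = (σ k : ℂ) * chi (dblPer n) (dblBox n k) x) :
    (foldOp n A).det = ∏ k : KingBox n, σ k :=
  det_eq_prod_of_boxWave_eigen n _ σ fun k => foldOp_mulVec_boxWave n hA k (hq k)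

/-- ★★ **`tr fold(A) = Σ_{k∈Ω} σ(k)`.** [cite: King1986, §4 p.670, (4.35) p.674] -/
theorem trace_foldOp_eq_sum {A : Matrix (Tor (dblPer n)) (Tor (dblPer n)) ℝ} (hA : IsReflSymm n A) (σ : KingBox n → ℝ)
    (hq : ∀ (k : KingBox n) (x : Tor (dblPer n)), ∑ y, (A x y : ℂ) * chi (dblPer n) (dblBox n k) y = (σ k : ℂ) * chi (dblPer n) (dblBox n k) x) :
    (foldOp n A).trace = ∑ k : KingBox n, σ k :=
  trace_eq_sum_of_boxWave_eigen n _ σ fun k => foldOp_mulVec_boxWave n hA k (hq k)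

/-- the inverse of the folded operator on the cosine waves: `fold(A)⁻¹w_k = σ(k)⁻¹w_k` (all `σ ≠ 0`). [folklore] -/
theorem foldOp_inv_mulVec_boxWave {A : Matrix (Tor (dblPer n)) (Tor (dblPer n)) ℝ} (hA : IsReflSymm n A) (σ : KingBox n → ℝ)
    (hq : ∀ (k : KingBox n) (x : Tor (dblPer n)), ∑ y, (A x y : ℂ) * chi (dblPer n) (dblBox n k) y = (σ k : ℂ) * chi (dblPer n) (dblBox n k) x)
    (hσ : ∀ k, σ k ≠ 0) (k : KingBox n) : (foldOp n A)⁻¹ *ᵥ boxWave n k = (σ k)⁻¹ • boxWave n k :=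
  inv_mulVec_boxWave_of_eigen n _ σ (fun k' => foldOp_mulVec_boxWave n hA k' (hq k')) hσ k

end Folded

/-! ## §4 Operators in King's plane-wave form -/

section FourierForm

variable (M : Fin (d + 1) → ℕ) [hM : ∀ μ, NeZero (M μ)]

/-- ★★ **PLANE-WAVE FORM ⇒ EIGEN-EQUATION**: if `A(b,b′) = |Ω|⁻¹Σ_q τ(q)·Re e^{iq·(b′−b)}` with an even real symbol `τ`, then `Σ_y A(x,y)e^{iq·y} = τ(q)e^{iq·x}` for every momentum
`q` (character orthogonality). [cite: King1986, (4.5) p.670, (4.35) p.674; Balaban1984PropagatorsI, (1.29) p.23] -/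
theorem eigen_chi_of_fourierForm (A : Matrix (Tor M) (Tor M) ℝ) (τ : Tor M → ℝ) (hτ : ∀ q, τ (-q) = τ q)
    (hA : ∀ b b', A b b' = (Fintype.card (Tor M) : ℝ)⁻¹ * ∑ q : Tor M, τ q * (chi M q (b' - b)).re) (q x : Tor M) :
    ∑ y, (A x y : ℂ) * chi M q y = (τ q : ℂ) * chi M q x := by
  have hcard : (Fintype.card (Tor M) : ℂ) ≠ 0 := by exact_mod_cast Fintype.card_ne_zero
  have hAC : ∀ y, (A x y : ℂ) = (Fintype.card (Tor M) : ℂ)⁻¹ * ∑ q' : Tor M, (τ q' : ℂ) * chi M q' (y - x) := by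
    intro y
    rw [hA, Complex.ofReal_mul, Complex.ofReal_inv, Complex.ofReal_natCast, ← sum_evenSymbol_chi_eq_re M τ hτ]
  simp_rw [hAC, Finset.mul_sum, Finset.sum_mul]
  rw [Finset.sum_comm]
  have inner : ∀ q' : Tor M, ∑ y : Tor M, (Fintype.card (Tor M) : ℂ)⁻¹ * ((τ q' : ℂ) * chi M q' (y - x)) * chi M q y
      = if q' + q = 0 then (τ q' : ℂ) * chi M q' (-x) else 0 := by
    intro q'
    have e : ∀ y : Tor M, (Fintype.card (Tor M) : ℂ)⁻¹ * ((τ q' : ℂ) * chi M q' (y - x)) * chi M q y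
        = (Fintype.card (Tor M) : ℂ)⁻¹ * ((τ q' : ℂ) * chi M q' (-x)) * chi M (q' + q) y := by
      intro y
      rw [sub_eq_add_neg, chi_add_right, chi_add_left]
      ring
    simp_rw [e]
    rw [← Finset.mul_sum, sum_chi]
    split_ifs with h
    · field_simp
    · rw [mul_zero]
  simp_rw [inner]
  rw [Finset.sum_ite, Finset.sum_const_zero, add_zero]
  have hfilter : Finset.univ.filter (fun q' : Tor M => q' + q = 0) = {-q} := by
    ext q'
    simp only [Finset.mem_filter, Finset.mem_univ, true_and, Finset.mem_singleton]
    exact add_eq_zero_iff_eq_neg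
  rw [hfilter, Finset.sum_singleton, hτ, chi_neg_neg]

variable (n : Fin (d + 1) → ℕ) [hn : ∀ μ, NeZero (n μ)]

/-- ★★ **THE DETERMINANT OF A FOLDED OPERATOR IN PLANE-WAVE FORM**: `A(b,b′) = |T|⁻¹Σ_q τ(q)Re e^{iq·(b′−b)}` on the doubled torus with an even symbol `τ` and `A` reflection
symmetric ⇒ `det fold(A) = Π_{k∈Ω} τ(k̂)`. [cite: King1986, §4 p.670 l.8–13, (3.89) p.668, (4.35) p.674] -/
theorem det_foldOp_eq_prod_of_fourierForm (A : Matrix (Tor (dblPer n)) (Tor (dblPer n)) ℝ) (hA : IsReflSymm n A) (τ : Tor (dblPer n) → ℝ) (hτ : ∀ q, τ (-q) = τ q)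
    (hF : ∀ b b', A b b' = (Fintype.card (Tor (dblPer n)) : ℝ)⁻¹ * ∑ q : Tor (dblPer n), τ q * (chi (dblPer n) q (b' - b)).re) :
    (foldOp n A).det = ∏ k : KingBox n, τ (dblBox n k) :=
  det_foldOp_eq_prod n hA (fun k => τ (dblBox n k)) fun k x => eigen_chi_of_fourierForm (dblPer n) A τ hτ hF (dblBox n k) x

/-- the cosine waves diagonalise a folded operator in plane-wave form: `fold(A)·w_k = τ(k̂)·w_k`. [cite: King1986, §4 p.670, (4.35) p.674] -/
theorem foldOp_mulVec_boxWave_of_fourierForm (A : Matrix (Tor (dblPer n)) (Tor (dblPer n)) ℝ) (hA : IsReflSymm n A) (τ : Tor (dblPer n) → ℝ) (hτ : ∀ q, τ (-q) = τ q)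
    (hF : ∀ b b', A b b' = (Fintype.card (Tor (dblPer n)) : ℝ)⁻¹ * ∑ q : Tor (dblPer n), τ q * (chi (dblPer n) q (b' - b)).re) (k : KingBox n) :
    foldOp n A *ᵥ boxWave n k = τ (dblBox n k) • boxWave n k :=
  foldOp_mulVec_boxWave n hA k fun x => eigen_chi_of_fourierForm (dblPer n) A τ hτ hF (dblBox n k) x

/-- and its trace: `tr fold(A) = Σ_{k∈Ω} τ(k̂)`. [cite: King1986, §4 p.670, (4.35) p.674] -/
theorem trace_foldOp_eq_sum_of_fourierForm (A : Matrix (Tor (dblPer n)) (Tor (dblPer n)) ℝ) (hA : IsReflSymm n A) (τ : Tor (dblPer n) → ℝ) (hτ : ∀ q, τ (-q) = τ q)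
    (hF : ∀ b b', A b b' = (Fintype.card (Tor (dblPer n)) : ℝ)⁻¹ * ∑ q : Tor (dblPer n), τ q * (chi (dblPer n) q (b' - b)).re) :
    (foldOp n A).trace = ∑ k : KingBox n, τ (dblBox n k) :=
  trace_foldOp_eq_sum n hA (fun k => τ (dblBox n k)) fun k x => eigen_chi_of_fourierForm (dblPer n) A τ hτ hF (dblBox n k) x

end FourierForm

end Summit.QuantumFields.YangMills.BalabanUVNodes.N15KingModelRung.TorusSpectral

end
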